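import Literature.Computability.AlgebraicComplexity.BI17FundamentalInvariantForms
import Literature.Computability.AlgebraicComplexity.MS2001ClassVarieties
import Literature.AlgebraicGeometry.PlaneCurves.HessianCovariance
import Mathlib.Algebra.MvPolynomial.PDeriv
import HarnessLib

/-!
# The polystability criterion for forms, BI 2017 Prop. 2.8, is false as printed: a counterexample

P. Bürgisser, C. Ikenmeyer, *Fundamental invariants of orbit closures*, J. Algebra **477** (2017)
390–434 = arXiv:1511.02927 [BurgisserIkenmeyer2017], §2.2, Prop. 2.8 (TeX `main.tex` L565–608,
held text `paper:arxiv-1511.02927` p0006:L140): "Let the form `w ∈ Sym^D ℂ^m` satisfy the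
following two properties: 1. There is a reductive subgroup `R` of `SL_m ∩ stab(w)` such that the
centralizer of `R` in `SL_m` is contained in the group of diagonal matrices. 2. The convex cone
generated by `supp(w)` contains `(1,…,1)`. Then `w` is polystable." The tree types its diagonal-`R`
case as the named fact `Literature.Computability.AlgebraicComplexity.BI2017_prop_2_8_diag`
(`BI17FundamentalInvariantForms.lean`): condition 2 reads `(1,…,1) = ∑_{α ∈ supp(w)} c_α α` with
rational `c_α ≥ 0`.

**This file proves `¬ BI2017_prop_2_8_diag` (`not_BI2017_prop_2_8_diag`)** — the forms twin of
`not_BI2017_prop_4_8_diag` (`BI17PolystabilityCriterionCounterexample.lean`; cell `val-lit`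
erratum A31). The printed proof (L583–603) ends "`∑_i μ_i = ⟨(1,…,1), μ⟩ ≥ 0`. On the other hand
`∑_i μ_i = 0`. This implies `μ_i = 0` for all `i`": but from `⟨α, μ⟩ ≥ 0` on `supp(w)` and
`∑_α c_α ⟨α, μ⟩ = 0` one only gets `⟨α, μ⟩ = 0` for the `α` with `c_α > 0`; a diagonal one-parameter
subgroup vanishing on those and positive on the rest of `supp(w)` survives. The statement becomes
correct when ALL `c_α`, `α ∈ supp(w)`, are positive (`(1,…,1)` in the relative interior of the
cone; Derksen–Makam's form of the criterion), which is the case of every application in the paper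
(Cor. 2.9: `X₁⋯X_m`, `∑ X_i^D`, `det_n`, `per_n` — tree theorems
`BI2017_cor_2_9_chow_powerSum_holds`, `BurgisserIkenmeyer2017_polystable_det_per_holds`).

## The counterexample (`m = 3`, `D = 3`)

`f = X₀³ + X₀X₁X₂`.
* Hypothesis 2: `c = 𝟙_{(1,1,1)}`: `(1,1,1) = 1·(1,1,1)`, `c ≥ 0` (and `c` vanishes on `(3,0,0)`).
* Hypothesis 1: `R :=` the diagonal matrices of `SL_3(ℂ)` fixing `f` (a subgroup,
  `exists_diagonalStabilizer_subgroup_form`; `= {diag(ζ, u, ζ⁻¹u⁻¹) : ζ³ = 1}`, diagonalizable hence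
  reductive, so the printed hypothesis holds too) contains `r₀ = diag(1, 2, 1/2)` with pairwise
  distinct entries, so its centralizer in `SL_3` is diagonal.
* Not polystable: with `σ(t) = diag(t, 1, t⁻¹) ∈ SL_3`, `σ(t)·f = t³X₀³ + X₀X₁X₂`, a polynomial
  family in `t` whose value at `t = 0` is `u = X₀X₁X₂`; so the coefficient vector of `u` lies in the
  Zariski closure of the `SL_3`-orbit of `f` (tree: `coeffVec_map_eval_zero_mem_zariskiClosure_of_family`).
  But `u ∉ SL_3·f`: if `f ∘ M = u` (`det M ≠ 0`) then the singular points `e₀, e₁, e₂` of the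
  triangle `{u = 0}` give three singular points `Me_s` of `{f = 0}` (tree:
  `grad_bind₁_toMvPolynomial_eq_zero_iff`), and every singular point of `f = X₀(X₀² + X₁X₂)` has
  first coordinate `0` (`∇f = (3X₀² + X₁X₂, X₀X₂, X₀X₁)`), so the first row of `M` vanishes and
  `det M = 0`. (An alternative certificate, found independently by seat `val-lit-t04 g4`: the
  Hessian covariant, `He(X₀³ + X₀X₁X₂) = −6X₀³ + 2X₀X₁X₂` versus `He(X₀X₁X₂) = 2X₀X₁X₂`, via the
  tree's `det_hessianMatrix_bind₁_toMvPolynomial`.)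

Cell `val-lit`, row BI2017-A (erratum A31, print-side). Honest framing: bookkeeping of BI 2017
§2.2; VP ≠ VNP is NOT proved and nothing here bears on it.

## References

* [BurgisserIkenmeyer2017] P. Bürgisser, C. Ikenmeyer, *Fundamental invariants of orbit closures*,
  J. Algebra 477 (2017) 390–434; arXiv:1511.02927, §2.2, Prop. 2.8 and its proof.
* H. Derksen, V. Makam, *An exponential lower bound for the degrees of invariants of cubic forms and
  tensor actions*, Adv. Math. / JCA (2022), Lemma 3.1 (the corrected, relative-interior form).
-/

noncomputable section

open MvPolynomial

namespace Literature.Computability.AlgebraicComplexity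

/-! ### General lemmas -/

section General

variable {σ : Type*} [Fintype σ] [DecidableEq σ] {k : Type*} [Field k]

/-- A matrix commuting with a diagonal matrix whose entries are pairwise distinct is diagonal
(BI 2017, proof of Cor. 2.9, L600: "`rg = gr`, which implies `r_i g_{ij} = g_{ij} r_j`, hence
`g_{ij} = 0`"). [cite: BurgisserIkenmeyer2017, Cor. 2.9 (proof)] -/
private theorem isDiag_of_commute_diagonal_form {M : Matrix σ σ k} {d : σ → k}
    (hd : ∀ i j, i ≠ j → d i ≠ d j) (h : M * Matrix.diagonal d = Matrix.diagonal d * M) :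
    M.IsDiag := by
  unfold Matrix.IsDiag Pairwise
  intro i j hij
  have h1 := congr_fun (congr_fun h i) j
  rw [Matrix.mul_diagonal, Matrix.diagonal_mul] at h1
  have h2 : M i j * (d j - d i) = 0 := by rw [mul_sub, h1]; ring
  rcases mul_eq_zero.mp h2 with h3 | h3
  · exact h3
  · exact absurd (sub_eq_zero.mp h3).symm (hd i j hij)

/-- A product of diagonal matrices is diagonal. [folklore] -/
private theorem isDiag_mul_form {A B : Matrix σ σ k} (hA : A.IsDiag) (hB : B.IsDiag) :
    (A * B).IsDiag := by
  rw [← Matrix.IsDiag.diagonal_diag hA, ← Matrix.IsDiag.diagonal_diag hB,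
    Matrix.diagonal_mul_diagonal]
  exact Matrix.isDiag_diagonal _

/-- The diagonal matrices of `SL(σ)` fixing a polynomial `f` under linear substitution form a
subgroup (the diagonal part of `SL ∩ stab(f)`, BI 2017 §2.2). [cite: BurgisserIkenmeyer2017, Prop. 2.8 / Cor. 2.9 (proof)] -/
theorem exists_diagonalStabilizer_subgroup_form (f : MvPolynomial σ k) :
    ∃ R : Subgroup (Matrix.SpecialLinearGroup σ k),
      ∀ g, g ∈ R ↔ ((g : Matrix σ σ k).IsDiag ∧ linSubst σ k (g : Matrix σ σ k) f = f) := by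
  set S : Set (Matrix.SpecialLinearGroup σ k) :=
    {g | (g : Matrix σ σ k).IsDiag ∧ linSubst σ k (g : Matrix σ σ k) f = f} with hS
  refine ⟨{ carrier := S, mul_mem' := ?_, one_mem' := ?_, inv_mem' := ?_ }, fun g => Iff.rfl⟩
  · rintro a b ⟨ha, haf⟩ ⟨hb, hbf⟩
    refine ⟨?_, ?_⟩
    · rw [Matrix.SpecialLinearGroup.coe_mul]; exact isDiag_mul_form ha hb
    · rw [Matrix.SpecialLinearGroup.coe_mul, linSubst_mul, AlgHom.comp_apply, hbf, haf]
  · refine ⟨?_, ?_⟩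
    · rw [Matrix.SpecialLinearGroup.coe_one]; exact Matrix.isDiag_one
    · rw [Matrix.SpecialLinearGroup.coe_one, linSubst_one, AlgHom.id_apply]
  · rintro g ⟨hg, hgf⟩
    refine ⟨?_, ?_⟩
    · rw [Matrix.SpecialLinearGroup.coe_inv, ← (Matrix.isDiag_iff_diagonal_diag _).mp hg,
        Matrix.adjugate_diagonal]
      exact Matrix.isDiag_diagonal _
    · have hm : ((g⁻¹ : Matrix.SpecialLinearGroup σ k) : Matrix σ σ k) * (g : Matrix σ σ k) = 1 := by
        rw [← Matrix.SpecialLinearGroup.coe_mul, inv_mul_cancel, Matrix.SpecialLinearGroup.coe_one]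
      conv_lhs => rw [← hgf]
      rw [← AlgHom.comp_apply, ← linSubst_mul, hm, linSubst_one, AlgHom.id_apply]

/-- The tree's `linSubst A` (`X_i ↦ ∑_j A_{ji} X_j`, i.e. `(A·p)(x) = p(Aᵀx)`) is Mathlib's
substitution `bind₁ (Aᵀ).toMvPolynomial` (`x ↦ Aᵀx`). [folklore] -/
private theorem linSubst_eq_bind₁ {m : ℕ} (A : Matrix (Fin m) (Fin m) k)
    (p : MvPolynomial (Fin m) k) :
    linSubst (Fin m) k A p = bind₁ A.transpose.toMvPolynomial p := by
  have h : linSubst (Fin m) k A = bind₁ A.transpose.toMvPolynomial := by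
    apply MvPolynomial.algHom_ext
    intro i
    rw [linSubst_X, bind₁_X_right, Matrix.toMvPolynomial]
    refine Finset.sum_congr rfl fun j _ => ?_
    rw [Matrix.transpose_apply, smul_eq_C_mul, ← pow_one (X j), C_mul_X_pow_eq_monomial]
  rw [h]

/-- A diagonal substitution rescales each variable. [folklore] -/
private theorem linSubst_diagonal_X_form (v : σ → k) (i : σ) :
    linSubst σ k (Matrix.diagonal v) (X i) = v i • X i := by
  rw [linSubst_X, Finset.sum_eq_single i (fun j _ hji => by
    rw [Matrix.diagonal_apply_ne _ hji, zero_smul]) (fun h => absurd (Finset.mem_univ i) h),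
    Matrix.diagonal_apply_eq]

/-- Linear substitution by a diagonal matrix rescales the variables of a product. [folklore] -/
private theorem linSubst_diagonal_cubicCex (d : Fin 3 → ℂ) :
    linSubst (Fin 3) ℂ (Matrix.diagonal d) (X 0 ^ 3 + X 0 * X 1 * X 2) =
      (d 0 ^ 3) • X 0 ^ 3 + (d 0 * d 1 * d 2) • (X 0 * X 1 * X 2) := by
  rw [map_add, map_pow, map_mul, map_mul, linSubst_diagonal_X_form, linSubst_diagonal_X_form,
    linSubst_diagonal_X_form, smul_pow, smul_mul_smul_comm, smul_mul_smul_comm]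

end General

/-! ### The counterexample form `f = X₀³ + X₀X₁X₂` -/

section Cex

/-- `X₀X₁X₂` is not in the `SL_3(ℂ)`-orbit of `f = X₀³ + X₀X₁X₂` (indeed not in its `GL_3`-orbit):
the singular locus of the triangle `{X₀X₁X₂ = 0}` spans `ℂ³`, that of `{f = 0}` lies in
`{X₀ = 0}`. [cite: BurgisserIkenmeyer2017, Prop. 2.8 (counterexample)] -/
theorem linSubst_cubicCex_ne_prodX (g : Matrix.SpecialLinearGroup (Fin 3) ℂ) :
    linSubst (Fin 3) ℂ (g : Matrix (Fin 3) (Fin 3) ℂ) (X 0 ^ 3 + X 0 * X 1 * X 2) ≠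
      X 0 * X 1 * X 2 := by
  intro h
  set M : Matrix (Fin 3) (Fin 3) ℂ := (g : Matrix (Fin 3) (Fin 3) ℂ).transpose with hM
  have hdet : M.det ≠ 0 := by
    rw [hM, Matrix.det_transpose, g.2]; exact one_ne_zero
  rw [linSubst_eq_bind₁] at h
  -- the gradient of `f` at `M e_s` vanishes, for every `s`
  have hsing : ∀ s : Fin 3, (fun j => eval (M.mulVec (Pi.single s 1))
      (pderiv j (X 0 ^ 3 + X 0 * X 1 * X 2 : MvPolynomial (Fin 3) ℂ))) = 0 := by
    intro s
    rw [← Literature.AlgebraicGeometry.PlaneCurves.grad_bind₁_toMvPolynomial_eq_zero_iff hdet, h]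
    funext j
    simp only [Pi.zero_apply]
    fin_cases j <;> fin_cases s <;> simp
  -- hence the first row of `M` vanishes
  have hrow : ∀ s : Fin 3, M 0 s = 0 := by
    intro s
    have hs := hsing s
    have e0 := congr_fun hs 0
    have e1 := congr_fun hs 1
    have e2 := congr_fun hs 2
    simp only [Pi.zero_apply, map_add, pderiv_mul, pderiv_pow, pderiv_X_self, pderiv_X_of_ne,
      ne_eq, Fin.reduceEq, not_false_eq_true, mul_zero, add_zero, zero_mul, zero_add, mul_one,
      map_mul, map_natCast, map_pow, eval_X, Matrix.mulVec_single_one] at e0 e1 e2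
    -- e1 : M 0 s * M 2 s = 0 ; e2 : M 0 s * M 1 s = 0 ; e0 : 3 * M 0 s ^ 2 + M 1 s * M 2 s = 0
    by_contra h0
    have h2 : M.col s 2 = 0 := by
      rcases mul_eq_zero.mp e1 with h' | h'
      · exact absurd h' h0
      · exact h'
    have h00 : (3 : ℂ) * M.col s 0 ^ (3 - 1) = 0 := by
      have := e0; rw [h2, mul_zero, add_zero] at this; exact this
    have : M.col s 0 = 0 := by
      have h3 : (3 : ℂ) ≠ 0 := by norm_num
      exact pow_eq_zero_iff (n := 3 - 1) (by norm_num) |>.mp ((mul_eq_zero.mp h00).resolve_left h3)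
    exact h0 this
  exact hdet (Matrix.det_eq_zero_of_row_eq_zero 0 hrow)

/-- **BI 2017 Prop. 2.8 is false as printed (and as typed): `¬ BI2017_prop_2_8_diag`.**
Witness: `m = D = 3`, `f = X₀³ + X₀X₁X₂`, `R` = the diagonal part of `SL_3 ∩ stab(f)` (contains
`diag(1, 2, 1/2)` with distinct entries, so its centralizer is diagonal), `c = 𝟙_{(1,1,1)}`; `f` is
not polystable because `X₀X₁X₂ = lim_{t→0} diag(t,1,t⁻¹)·f` lies in the Zariski closure of `SL_3·f`
but not in `SL_3·f`. [cite: BurgisserIkenmeyer2017, Prop. 2.8 (counterexample)] -/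
theorem not_BI2017_prop_2_8_diag : ¬ BI2017_prop_2_8_diag := by
  intro hP
  set f : MvPolynomial (Fin 3) ℂ := X 0 ^ 3 + X 0 * X 1 * X 2 with hf
  -- homogeneity
  have hhom : f.IsHomogeneous 3 := by
    have h1 : (X 0 ^ 3 : MvPolynomial (Fin 3) ℂ).IsHomogeneous 3 := by
      simpa using (isHomogeneous_X ℂ (0 : Fin 3)).pow 3
    have h2 : (X 0 * X 1 * X 2 : MvPolynomial (Fin 3) ℂ).IsHomogeneous 3 := by
      simpa using ((isHomogeneous_X ℂ (0 : Fin 3)).mul (isHomogeneous_X ℂ (1 : Fin 3))).mul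
        (isHomogeneous_X ℂ (2 : Fin 3))
    exact h1.add h2
  -- the diagonal stabilizer and its explicit element `diag(1, 2, 1/2)`
  obtain ⟨R, hR⟩ := exists_diagonalStabilizer_subgroup_form (σ := Fin 3) (k := ℂ) f
  have hd : (Matrix.diagonal ![(1 : ℂ), 2, 1 / 2]).det = 1 := by
    norm_num [Matrix.det_diagonal, Fin.prod_univ_three, Matrix.cons_val_two, Matrix.tail_cons,
      Matrix.head_cons]
  set r₀ : Matrix.SpecialLinearGroup (Fin 3) ℂ := ⟨_, hd⟩ with hr₀
  have hr₀R : r₀ ∈ R := by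
    refine (hR r₀).mpr ⟨Matrix.isDiag_diagonal _, ?_⟩
    change linSubst (Fin 3) ℂ (Matrix.diagonal ![(1 : ℂ), 2, 1 / 2]) f = f
    rw [hf, linSubst_diagonal_cubicCex]
    norm_num [Matrix.cons_val_two, Matrix.tail_cons, Matrix.head_cons]
  -- `f` would be polystable
  have hpoly : IsPolystable f := by
    refine hP 3 3 f hhom R (fun r hr => (hR r).mp hr) ?_ ?_
    · intro g hg
      have hc := hg r₀ hr₀R
      have h1 : (g : Matrix (Fin 3) (Fin 3) ℂ) * Matrix.diagonal ![(1 : ℂ), 2, 1 / 2] =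
          Matrix.diagonal ![(1 : ℂ), 2, 1 / 2] * (g : Matrix (Fin 3) (Fin 3) ℂ) := by
        have := congrArg (fun x : Matrix.SpecialLinearGroup (Fin 3) ℂ =>
          (x : Matrix (Fin 3) (Fin 3) ℂ)) hc
        simpa [hr₀] using this
      refine isDiag_of_commute_diagonal_form ?_ h1
      intro i j hij
      fin_cases i <;> fin_cases j <;>
        first | exact absurd rfl hij |
          norm_num [Matrix.cons_val_two, Matrix.tail_cons, Matrix.head_cons]
    · -- `c = 𝟙_{(1,1,1)}`
      set α₀ : Fin 3 →₀ ℕ := Finsupp.single 0 1 + Finsupp.single 1 1 + Finsupp.single 2 1 with hα₀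
      have hα₀mem : α₀ ∈ f.support := by
        rw [MvPolynomial.mem_support_iff, hf, coeff_add]
        have hX3 : (X 0 ^ 3 : MvPolynomial (Fin 3) ℂ) = monomial (Finsupp.single 0 3) 1 :=
          X_pow_eq_monomial
        have hU : (X 0 * X 1 * X 2 : MvPolynomial (Fin 3) ℂ) = monomial α₀ 1 := by
          rw [hα₀, X, X, X, monomial_mul, monomial_mul, mul_one, mul_one]
        rw [hX3, hU, coeff_monomial, coeff_monomial, if_pos rfl, if_neg]
        · norm_num
        · intro heq
          have := Finsupp.ext_iff.mp heq 1
          simp [hα₀] at this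
      refine ⟨fun α => if α = α₀ then 1 else 0, fun α => by positivity, fun i => ?_⟩
      simp only [ite_mul, one_mul, zero_mul, Finset.sum_ite_eq', hα₀mem, if_true]
      fin_cases i <;> simp [hα₀]
  -- the degeneration `diag(t,1,t⁻¹)·f = t³X₀³ + X₀X₁X₂ → X₀X₁X₂` puts `u` in the Zariski closure
  have hmem : coeffVec (X 0 * X 1 * X 2 : MvPolynomial (Fin 3) ℂ) ∈
      zariskiClosure (coeffVec '' slOrbit (Fin 3) ℂ f) := by
    have hfam := coeffVec_map_eval_zero_mem_zariskiClosure_of_family (slOrbit (Fin 3) ℂ f)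
      (C (Polynomial.X ^ 3) * X 0 ^ 3 + X 0 * X 1 * X 2 : MvPolynomial (Fin 3) (Polynomial ℂ))
      (fun t ht => ?_)
    · have h0 : MvPolynomial.map (Polynomial.evalRingHom 0)
          (C (Polynomial.X ^ 3) * X 0 ^ 3 + X 0 * X 1 * X 2 : MvPolynomial (Fin 3) (Polynomial ℂ))
          = X 0 * X 1 * X 2 := by
        simp [map_add, map_mul, map_pow, map_X, map_C]
      rwa [h0] at hfam
    · have hdt : (Matrix.diagonal ![t, 1, t⁻¹]).det = 1 := by
        rw [Matrix.det_diagonal, Fin.prod_univ_three]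
        simp [ht, Matrix.cons_val_two, Matrix.tail_cons, Matrix.head_cons]
      refine ⟨⟨Matrix.diagonal ![t, 1, t⁻¹], hdt⟩, ?_⟩
      change _ = linSubst (Fin 3) ℂ (Matrix.diagonal ![t, 1, t⁻¹]) f
      rw [hf, linSubst_diagonal_cubicCex]
      simp only [map_add, map_mul, map_pow, map_X, map_C, Polynomial.coe_evalRingHom,
        Polynomial.eval_X, Matrix.cons_val_zero, Matrix.cons_val_one,
        Matrix.head_cons, Matrix.cons_val_two, Matrix.tail_cons]
      rw [mul_one, mul_inv_cancel₀ ht, one_smul, smul_eq_C_mul, map_pow]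
  have hin : coeffVec (X 0 * X 1 * X 2 : MvPolynomial (Fin 3) ℂ) ∈ coeffVec '' slOrbit (Fin 3) ℂ f :=
    hpoly hmem
  obtain ⟨h, ⟨g, hg⟩, hcoeff⟩ := hin
  have heq : linSubst (Fin 3) ℂ (g : Matrix (Fin 3) (Fin 3) ℂ) f = X 0 * X 1 * X 2 := by
    rw [← hg]
    exact MvPolynomial.ext _ _ fun d => congr_fun hcoeff d
  exact linSubst_cubicCex_ne_prodX g (by rw [hf] at heq; exact heq)

end Cex

end Literature.Computability.AlgebraicComplexity
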